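import Mathlib
import Literature.MathematicalPhysics.QuantumLattice.GrassmannIntegralProofs
import Summits.QuantumFields.QCD.Theorems.WilsonQuarkChessboardBackgroundSchwarzRot

/-!
# The rotated spin factors, explicitly (helper for `BackgroundSchwarz`)

Explicit values of `rotF[μ] = -¼ 𝐒 (1 - γ_μ) 𝐒ᴴ` and `rotG[μ] = -¼ 𝐒 (1 + γ_μ) 𝐒ᴴ` in the
`γ₀`-diagonal basis (`𝐒 γ₀ 𝐒ᴴ = 2·diag(1,1,-1,-1)`): `rotF[0] = -diag(0,0,1,1)` and
`rotG[0] = -diag(1,1,0,0)` are the projections onto the `γ₀ = ∓1` components (Lüscher's `η`/`ξ`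
split, Montvay–Münster (4.102)), and for the spatial directions the factors are Hermitian with
diagonal `2 × 2` blocks `-½·1` and opposite off-diagonal blocks (`γ_k` anticommutes with `γ₀`).
The spin index is written `spin4[σ, s]` (`σ` = sign block, `s` = component).
-/

noncomputable section

namespace Summit.QuantumFields.QCD.Theorems.BackgroundSchwarz

open Matrix Complex Finset
open Literature.MathematicalPhysics.QuantumLattice

/-- `spin4` is injective. -/
theorem spin4_inj {σ s σ' s' : Fin 2} (h : spin4[σ, s] = spin4[σ', s']) : σ = σ' ∧ s = s' := by
  fin_cases σ <;> fin_cases s <;> fin_cases σ' <;> fin_cases s' <;> simp_all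

/-- `spin4` is surjective. -/
theorem spin4_surj (α : Fin 4) : ∃ σ s : Fin 2, spin4[σ, s] = α := by
  fin_cases α
  · exact ⟨0, 0, rfl⟩
  · exact ⟨0, 1, rfl⟩
  · exact ⟨1, 0, rfl⟩
  · exact ⟨1, 1, rfl⟩

/-! ## Explicit matrices -/

/-- The identity of `Matrix (Fin 4) (Fin 4) ℂ` in matrix notation. -/
theorem one_fin_four : (1 : Matrix (Fin 4) (Fin 4) ℂ) = !![1, 0, 0, 0; 0, 1, 0, 0; 0, 0, 1, 0; 0, 0, 0, 1] := by
  ext i j; fin_cases i <;> fin_cases j <;> rfl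

/-- `𝐒ᴴ` in matrix notation. -/
theorem rotS_conjTranspose : (rot𝐒)ᴴ = !![1, 0, 1, 0; 0, 1, 0, 1; 0, I, 0, -I; I, 0, -I, 0] := by
  ext i j; fin_cases i <;> fin_cases j <;> simp [Matrix.conjTranspose_apply]


/-- `rotF[0] = -diag(0,0,1,1)`. -/
theorem rotF_zero : rotF[(0 : Fin 4)] = !![0, 0, 0, 0; 0, 0, 0, 0; 0, 0, -1, 0; 0, 0, 0, -1] := by
  rw [euclideanGamma_zero, rotS_conjTranspose, one_fin_four]
  norm_num [Matrix.smul_of, Matrix.smul_cons, Matrix.smul_empty, Complex.ext_iff]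
  ext i; fin_cases i <;> rfl

/-- `rotG[0] = -diag(1,1,0,0)`. -/
theorem rotG_zero : rotG[(0 : Fin 4)] = !![-1, 0, 0, 0; 0, -1, 0, 0; 0, 0, 0, 0; 0, 0, 0, 0] := by
  rw [euclideanGamma_zero, rotS_conjTranspose, one_fin_four]
  norm_num [Matrix.smul_of, Matrix.smul_cons, Matrix.smul_empty, Complex.ext_iff]
  ext i; fin_cases i <;> rfl

/-- `rotF[1]`. -/
theorem rotF_one : rotF[(1 : Fin 4)] =
    !![-1/2, 0, I/2, 0; 0, -1/2, 0, -I/2; -I/2, 0, -1/2, 0; 0, I/2, 0, -1/2] := by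
  rw [euclideanGamma_one, rotS_conjTranspose, one_fin_four]
  norm_num [Matrix.smul_of, Matrix.smul_cons, Matrix.smul_empty, Complex.ext_iff]

/-- `rotG[1]`. -/
theorem rotG_one : rotG[(1 : Fin 4)] =
    !![-1/2, 0, -I/2, 0; 0, -1/2, 0, I/2; I/2, 0, -1/2, 0; 0, -I/2, 0, -1/2] := by
  rw [euclideanGamma_one, rotS_conjTranspose, one_fin_four]
  norm_num [Matrix.smul_of, Matrix.smul_cons, Matrix.smul_empty, Complex.ext_iff]

/-- `rotF[2]`. -/
theorem rotF_two : rotF[(2 : Fin 4)] =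
    !![-1/2, 0, 0, -1/2; 0, -1/2, 1/2, 0; 0, 1/2, -1/2, 0; -1/2, 0, 0, -1/2] := by
  rw [euclideanGamma_two, rotS_conjTranspose, one_fin_four]
  norm_num [Matrix.smul_of, Matrix.smul_cons, Matrix.smul_empty, Complex.ext_iff]

/-- `rotG[2]`. -/
theorem rotG_two : rotG[(2 : Fin 4)] =
    !![-1/2, 0, 0, 1/2; 0, -1/2, -1/2, 0; 0, -1/2, -1/2, 0; 1/2, 0, 0, -1/2] := by
  rw [euclideanGamma_two, rotS_conjTranspose, one_fin_four]
  norm_num [Matrix.smul_of, Matrix.smul_cons, Matrix.smul_empty, Complex.ext_iff]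

/-- `rotF[3]`. -/
theorem rotF_three : rotF[(3 : Fin 4)] =
    !![-1/2, 0, 0, -I/2; 0, -1/2, -I/2, 0; 0, I/2, -1/2, 0; I/2, 0, 0, -1/2] := by
  rw [euclideanGamma_three, rotS_conjTranspose, one_fin_four]
  norm_num [Matrix.smul_of, Matrix.smul_cons, Matrix.smul_empty, Complex.ext_iff]

/-- `rotG[3]`. -/
theorem rotG_three : rotG[(3 : Fin 4)] =
    !![-1/2, 0, 0, I/2; 0, -1/2, I/2, 0; 0, -I/2, -1/2, 0; -I/2, 0, 0, -1/2] := by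
  rw [euclideanGamma_three, rotS_conjTranspose, one_fin_four]
  norm_num [Matrix.smul_of, Matrix.smul_cons, Matrix.smul_empty, Complex.ext_iff]

/-! ## Entries in the `spin4` parametrisation -/

/-- `rotF[0]` is `-1` exactly on the diagonal of the `γ₀' = -1` block. -/
theorem rotF_zero_spin4 (σ s σ' s' : Fin 2) :
    rotF[(0 : Fin 4)] (spin4[σ, s]) (spin4[σ', s']) = if σ = 1 ∧ σ' = 1 ∧ s = s' then -1 else 0 := by
  rw [rotF_zero]
  fin_cases σ <;> fin_cases s <;> fin_cases σ' <;> fin_cases s' <;> simp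

/-- `rotG[0]` is `-1` exactly on the diagonal of the `γ₀' = +1` block. -/
theorem rotG_zero_spin4 (σ s σ' s' : Fin 2) :
    rotG[(0 : Fin 4)] (spin4[σ, s]) (spin4[σ', s']) = if σ = 0 ∧ σ' = 0 ∧ s = s' then -1 else 0 := by
  rw [rotG_zero]
  fin_cases σ <;> fin_cases s <;> fin_cases σ' <;> fin_cases s' <;> simp

/-- Spatial `rotF` on a diagonal sign block is `-½·1`. -/
theorem rotF_spin4_same {μ : Fin 4} (hμ : μ ≠ 0) (σ s s' : Fin 2) :
    rotF[μ] (spin4[σ, s]) (spin4[σ, s']) = if s = s' then -(1 / 2 : ℂ) else 0 := by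
  fin_cases μ
  · exact absurd rfl hμ
  · simp only [Fin.isValue, Fin.mk_one, rotF_one]
    fin_cases σ <;> fin_cases s <;> fin_cases s' <;> simp <;> norm_num
  · simp only [Fin.isValue, rotF_two, show (⟨2, by norm_num⟩ : Fin 4) = 2 from rfl]
    fin_cases σ <;> fin_cases s <;> fin_cases s' <;> simp <;> norm_num
  · simp only [Fin.isValue, rotF_three, show (⟨3, by norm_num⟩ : Fin 4) = 3 from rfl]
    fin_cases σ <;> fin_cases s <;> fin_cases s' <;> simp <;> norm_num

/-- Spatial `rotG` on a diagonal sign block is `-½·1`. -/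
theorem rotG_spin4_same {μ : Fin 4} (hμ : μ ≠ 0) (σ s s' : Fin 2) :
    rotG[μ] (spin4[σ, s]) (spin4[σ, s']) = if s = s' then -(1 / 2 : ℂ) else 0 := by
  fin_cases μ
  · exact absurd rfl hμ
  · simp only [Fin.isValue, Fin.mk_one, rotG_one]
    fin_cases σ <;> fin_cases s <;> fin_cases s' <;> simp <;> norm_num
  · simp only [Fin.isValue, rotG_two, show (⟨2, by norm_num⟩ : Fin 4) = 2 from rfl]
    fin_cases σ <;> fin_cases s <;> fin_cases s' <;> simp <;> norm_num
  · simp only [Fin.isValue, rotG_three, show (⟨3, by norm_num⟩ : Fin 4) = 3 from rfl]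
    fin_cases σ <;> fin_cases s <;> fin_cases s' <;> simp <;> norm_num

/-- Spatial `rotG` is `-rotF` on the off-diagonal sign blocks (`γ_k` anticommutes with `γ₀`). -/
theorem rotG_spin4_ne {μ : Fin 4} (hμ : μ ≠ 0) {σ σ' : Fin 2} (h : σ ≠ σ') (s s' : Fin 2) :
    rotG[μ] (spin4[σ, s]) (spin4[σ', s']) = -rotF[μ] (spin4[σ, s]) (spin4[σ', s']) := by
  fin_cases μ
  · exact absurd rfl hμ
  · simp only [Fin.isValue, Fin.mk_one, rotG_one, rotF_one]
    fin_cases σ <;> fin_cases s <;> fin_cases σ' <;> fin_cases s' <;> simp at h ⊢ <;> ring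
  · simp only [Fin.isValue, rotG_two, rotF_two, show (⟨2, by norm_num⟩ : Fin 4) = 2 from rfl]
    fin_cases σ <;> fin_cases s <;> fin_cases σ' <;> fin_cases s' <;> simp at h ⊢ <;> norm_num
  · simp only [Fin.isValue, rotG_three, rotF_three, show (⟨3, by norm_num⟩ : Fin 4) = 3 from rfl]
    fin_cases σ <;> fin_cases s <;> fin_cases σ' <;> fin_cases s' <;> simp at h ⊢ <;> ring

/-! ## Hermiticity -/

/-- `rotF[μ]` is Hermitian. -/
theorem rotF_isHermitian (μ : Fin 4) : (rotF[μ]).IsHermitian := by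
  have h1 : ((1 : Matrix (Fin 4) (Fin 4) ℂ) - euclideanGamma μ).IsHermitian :=
    isHermitian_one.sub (euclideanGamma_isHermitian μ)
  have h2 := isHermitian_mul_mul_conjTranspose (rot𝐒) h1
  unfold Matrix.IsHermitian at h2 ⊢
  rw [conjTranspose_smul, h2]
  congr 1
  simp

/-- `rotG[μ]` is Hermitian. -/
theorem rotG_isHermitian (μ : Fin 4) : (rotG[μ]).IsHermitian := by
  have h1 : ((1 : Matrix (Fin 4) (Fin 4) ℂ) + euclideanGamma μ).IsHermitian :=
    isHermitian_one.add (euclideanGamma_isHermitian μ)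
  have h2 := isHermitian_mul_mul_conjTranspose (rot𝐒) h1
  unfold Matrix.IsHermitian at h2 ⊢
  rw [conjTranspose_smul, h2]
  congr 1
  simp

/-- Entrywise Hermiticity of `rotF`. -/
theorem star_rotF_apply (μ : Fin 4) (α β : Fin 4) : star (rotF[μ] β α) = rotF[μ] α β :=
  (rotF_isHermitian μ).apply α β

/-- Entrywise Hermiticity of `rotG`. -/
theorem star_rotG_apply (μ : Fin 4) (α β : Fin 4) : star (rotG[μ] β α) = rotG[μ] α β :=
  (rotG_isHermitian μ).apply α β

end Summit.QuantumFields.QCD.Theorems.BackgroundSchwarz
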